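import Mathlib
import Summits.NavierStokesRegularity.NavierStokesRegularity.Theorems.TaoLadderRungTwoBreakOneShiftWindowResidualSlope
import Summits.NavierStokesRegularity.NavierStokesRegularity.Theorems.TaoLadderRungTwoBreakOneShiftWindowRunSlope
import Summits.NavierStokesRegularity.NavierStokesRegularity.Theorems.TaoLadderRungTwoBreakOneShiftWindowSlopeGrid
import Summits.NavierStokesRegularity.NavierStokesRegularity.Theorems.TaoLadderRungTwoBreakOneShiftWindowRTermD
import Summits.NavierStokesRegularity.NavierStokesRegularity.Theorems.TaoLadderRungTwoBreakOneShiftWindowBoxD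
import HarnessLib

/-!
# The one-shift window system, XLI: THE RESIDUAL SLOPE IN DYADIC INTERVAL ARITHMETIC — the interval evaluation
# `ResSlopeD.Nb` of part XI's `resSlope` (the kernel form of the engine's `[DG]` rows) over the final hull, the
# flow-slope box of the grid (part XL), the field-value hull, the `g`/`γ` ranges, the top-tail time-slope bound and
# the top tube, with its soundness `mem_resSlope`: the `[Nlo, Nhi]` of part X `K1_of_residualSlope` (cell
# harvest/h2-tao-ladder, seat p2; rung1/KERNEL-CHEAP-REPLAY-SPEC.md §2 (Krawczyk file), §6 (i), §8; support for
# K1(1) = `NoSurvivingDSSOne`, stmt-NavierStokesRegularity-20205)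

MODEL lattice ODEs only (Tao 2016 §4 normal form on Tao's shift set `S`); nothing here is a statement about
the Navier–Stokes equations; no item is closed; no instance is evaluated here.

INDEXING. Window coordinates are flat, `q = e (i, j) < n` for a numbering `e : Fin m × Fin W ≃ Fin n` fixed by the
instance; the flight-time coordinate (`none`) is slot `n`. The data carries the combinatorics of the frame as arrays
(`succ`: flat one-shift partner `(i, j+1)` or `none` for a top row; `mode`; `idx1`/`idxD`: flat `(i,1)` / `(i,D)`
per mode) whose agreement with `F` and `e` is a hypothesis of the soundness theorem (decidable per instance).
-/

-- the sub-problem namespace repeats the summit name by design (D-0017)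
set_option linter.dupNamespace false

namespace Summit.NavierStokesRegularity.NavierStokesRegularity.Theorems

namespace DSSOneShift

open Set Finset
open Summit.NavierStokesRegularity.NavierStokesRegularity.Theorems.TaylorModelCert
open Summit.NavierStokesRegularity.NavierStokesRegularity.Theorems.CertificateGlueOn

/-! ### Data and the interval residual slope -/

/-- **The dyadic data of the residual-slope evaluation.** [cite: Tao2016AveragedNS, §5.3; cell vocabulary, harvest/h2-tao-ladder rung1/KERNEL-CHEAP-REPLAY-SPEC.md §2 (Krawczyk file)] -/
structure ResSlopeD where
  /-- mantissa bits -/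
  prec : ℕ
  /-- number of window coordinates (slot `n` = flight time) -/
  n : ℕ
  /-- number of modes -/
  nm : ℕ
  /-- flat one-shift partner of a flat index, `none` for a top row -/
  succ : Array (Option ℕ)
  /-- mode of a flat index -/
  mode : Array ℕ
  /-- box radii `a` at flat indices -/
  aBox : Array IntervalD
  /-- flight-time radius `r_τ` -/
  rtau : IntervalD
  /-- flat index of `(i, 1)` per mode -/
  idx1 : Array ℕ
  /-- flat index of `(i, D)` per mode -/
  idxD : Array ℕ
  /-- range of the renormalisation factor `g` -/
  G : IntervalD
  /-- range of the rsqrt slope `γ` -/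
  Gam : IntervalD
  /-- hull of the two runs at their flight times (flat) -/
  Zb : Array IntervalD
  /-- flow-slope box (flat `n × n`, column-major) -/
  Ub : Array IntervalD
  /-- field-value hull (flat) -/
  Fv : Array IntervalD
  /-- bound of the top-tail time slopes `|ρ_i|` -/
  RW : Dyad
  /-- top tube at the flight time, per mode -/
  Ttop : Array IntervalD

namespace ResSlopeD

variable (d : ResSlopeD)

/-- Reader of a `ℕ` array (junk `0`). [folklore] -/
def natget (A : Array ℕ) (i : ℕ) : ℕ := if h : i < A.size then A[i] else 0

/-- Reader of an `Option ℕ` array (junk `none`). [folklore] -/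
def optget (A : Array (Option ℕ)) (i : ℕ) : Option ℕ := if h : i < A.size then A[i] else none

/-- The run-slope box `V q c`: window column `U[q][c] ⊗ a_c`, flight-time column `φ_q ⊗ r_τ`. [folklore] -/
def Vb (q c : ℕ) : IntervalD :=
  if c = d.n then IntervalD.mulR d.prec (IntervalD.aget d.Fv q) d.rtau
  else IntervalD.mulR d.prec (IntervalD.aget d.Ub (c * d.n + q)) (IntervalD.aget d.aBox c)

/-- `z_q + z'_q` over the hull. [folklore] -/
def zsum (q : ℕ) : IntervalD := IntervalD.add (IntervalD.aget d.Zb q) (IntervalD.aget d.Zb q)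

/-- The shell-1 coupling row `h_c = Σ_i (z_{i,1} + z'_{i,1}) V (i,1) c`. [folklore] -/
def hrowB (c : ℕ) : IntervalD :=
  IntervalD.rangeSumR d.prec (fun i => IntervalD.mulR d.prec (d.zsum (natget d.idx1 i)) (d.Vb (natget d.idx1 i) c)) d.nm

/-- The point interval `½`. [folklore] -/
def halfI : IntervalD := IntervalD.ofDyad ⟨1, -1⟩

/-- **The interval residual slope `Nb r c`.** [cite: Tao2016AveragedNS, §5.3; cell vocabulary, harvest/h2-tao-ladder rung1/KERNEL-CHEAP-REPLAY-SPEC.md §2 ([DG] rows)] -/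
def Nb (r c : ℕ) : IntervalD :=
  if r = d.n then
    IntervalD.mulR d.prec halfI
      (IntervalD.rangeSumR d.prec (fun i => IntervalD.mulR d.prec (d.zsum (natget d.idxD i)) (d.Vb (natget d.idxD i) c)) d.nm)
  else
    IntervalD.subR d.prec
      (match optget d.succ r with
        | some s => IntervalD.addR d.prec (IntervalD.mulR d.prec d.G (d.Vb s c))
            (IntervalD.mulR d.prec (IntervalD.mulR d.prec (IntervalD.aget d.Zb s) d.Gam) (d.hrowB c))
        | none => IntervalD.addR d.prec
            (IntervalD.mulR d.prec d.G (if c = d.n then IntervalD.mulR d.prec d.rtau (RFac.sym d.RW) else IntervalD.ofInt 0))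
            (IntervalD.mulR d.prec (IntervalD.mulR d.prec (IntervalD.aget d.Ttop (natget d.mode r)) d.Gam) (d.hrowB c)))
      (if c = r then IntervalD.aget d.aBox r else IntervalD.ofInt 0)

/-! ### Soundness -/

section Sound

variable {m : ℕ} (F : OneShiftFrame m) (e : Fin m × Fin F.W ≃ Fin d.n)

/-- The flat numbering of the block coordinates: window `(i,j) ↦ e (i,j)`, flight time `↦ n`. [folklore] -/
def eO : F.WIdx → ℕ := fun r => r.elim d.n fun p => (e p : ℕ)

/-- **THE DATA MATCHES THE FRAME**: the combinatorial arrays agree with `F` and `e`, the numeric boxes enclose the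
frame constants and the real arguments (a bookkeeping predicate; decidable resp. interval facts per instance).
[cite: Tao2016AveragedNS, §5.3; cell vocabulary, harvest/h2-tao-ladder rung1/KERNEL-CHEAP-REPLAY-SPEC.md §8] -/
structure Matches (hW1 : 1 < F.W) (hD : F.D < F.W) (g γ : ℝ) (z z' φ : Fin m → ℤ → ℝ)
    (Umat : Matrix (Fin m × Fin F.W) (Fin m × Fin F.W) ℝ) (ρ Ttop : Fin m → ℝ) : Prop where
  hm : d.nm = m
  hsucc : ∀ i (j : Fin F.W), optget d.succ (e (i, j)) =
    if h : (j : ℕ) + 1 < F.W then some ((e (i, ⟨(j : ℕ) + 1, h⟩) : ℕ)) else none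
  hmode : ∀ i (j : Fin F.W), natget d.mode (e (i, j)) = (i : ℕ)
  hidx1 : ∀ i : Fin m, natget d.idx1 i = (e (i, ⟨1, hW1⟩) : ℕ)
  hidxD : ∀ i : Fin m, natget d.idxD i = (e (i, ⟨F.D, hD⟩) : ℕ)
  ha : ∀ i (j : Fin F.W), IntervalD.mem (F.a i ((j : ℕ) : ℤ)) (IntervalD.aget d.aBox (e (i, j)))
  hrτ : IntervalD.mem F.rτ d.rtau
  hg : IntervalD.mem g d.G
  hγ : IntervalD.mem γ d.Gam
  hz : ∀ i (j : Fin F.W), IntervalD.mem (z i ((j : ℕ) : ℤ)) (IntervalD.aget d.Zb (e (i, j)))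
  hz' : ∀ i (j : Fin F.W), IntervalD.mem (z' i ((j : ℕ) : ℤ)) (IntervalD.aget d.Zb (e (i, j)))
  hU : ∀ p q : Fin m × Fin F.W, IntervalD.mem (Umat p q) (IntervalD.aget d.Ub ((e q : ℕ) * d.n + (e p : ℕ)))
  hφ : ∀ i (j : Fin F.W), IntervalD.mem (φ i ((j : ℕ) : ℤ)) (IntervalD.aget d.Fv (e (i, j)))
  hρ : ∀ i, |ρ i| ≤ d.RW.toReal
  hT : ∀ i : Fin m, IntervalD.mem (Ttop i) (IntervalD.aget d.Ttop i)

variable {d F e}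
variable {hW1 : 1 < F.W} {hD : F.D < F.W} {g γ : ℝ} {z z' φ : Fin m → ℤ → ℝ}
  {Umat : Matrix (Fin m × Fin F.W) (Fin m × Fin F.W) ℝ} {ρ Ttop : Fin m → ℝ}

/-- The run slope at a window shell lies in `Vb`. [folklore] -/
theorem mem_Vb (M : d.Matches F e hW1 hD g γ z z' φ Umat ρ Ttop) (i : Fin m) (j : Fin F.W) (c : F.WIdx) :
    IntervalD.mem (F.runSlopeOf (F.slopeOfFlat Umat) φ i ((j : ℕ) : ℤ) c) (d.Vb (e (i, j)) (d.eO F e c)) := by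
  have hne : ∀ p : Fin m × Fin F.W, ((e p : ℕ) = d.n) = False := fun p => by
    simp only [eq_iff_iff, iff_false]; exact (e p).isLt.ne
  rcases c with _ | p
  · simp only [OneShiftFrame.runSlopeOf, Option.elim, eO, Vb, if_true]
    exact IntervalD.mem_mulR d.prec (M.hφ i j) M.hrτ
  · simp only [OneShiftFrame.runSlopeOf, Option.elim, eO, Vb, hne p, if_false]
    have hin : F.InWindow ((j : ℕ) : ℤ) := F.inWindow_natCast j
    have hs : F.slopeOfFlat Umat i ((j : ℕ) : ℤ) p = Umat (i, j) p := by
      simp only [OneShiftFrame.slopeOfFlat, dif_pos hin, F.widx_natCast j hin]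
    rw [hs]
    exact IntervalD.mem_mulR d.prec (M.hU (i, j) p) (by simpa using M.ha p.1 p.2)

/-- `z + z'` at a window shell lies in `zsum`. [folklore] -/
theorem mem_zsum (M : d.Matches F e hW1 hD g γ z z' φ Umat ρ Ttop) (i : Fin m) (j : Fin F.W) :
    IntervalD.mem (z i ((j : ℕ) : ℤ) + z' i ((j : ℕ) : ℤ)) (d.zsum (e (i, j))) :=
  IntervalD.mem_add (M.hz i j) (M.hz' i j)

/-- The shell-1 coupling row lies in `hrowB`. [folklore] -/
theorem mem_hrowB (M : d.Matches F e hW1 hD g γ z z' φ Umat ρ Ttop) (c : F.WIdx) :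
    IntervalD.mem (F.hrow z z' (F.runSlopeOf (F.slopeOfFlat Umat) φ) c) (d.hrowB (d.eO F e c)) := by
  unfold OneShiftFrame.hrow hrowB
  rw [M.hm]
  refine mem_sum_equiv (Equiv.refl (Fin m)) d.prec fun k hk => ?_
  simp only [Equiv.refl_symm, Equiv.refl_apply]
  have h1 := M.hidx1 ⟨k, hk⟩
  simp only at h1
  rw [h1]
  have hz := mem_zsum M ⟨k, hk⟩ ⟨1, hW1⟩
  have hv := mem_Vb M ⟨k, hk⟩ ⟨1, hW1⟩ c
  simp only [Nat.cast_one] at hz hv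
  exact IntervalD.mem_mulR d.prec hz hv

/-- **THE INTERVAL RESIDUAL SLOPE ENCLOSES THE RESIDUAL SLOPE.** [cite: Tao2016AveragedNS, §5.3; Moore1979, §3.2; cell vocabulary, harvest/h2-tao-ladder rung1/KERNEL-CHEAP-REPLAY-SPEC.md §2 ([DG] rows)] -/
theorem mem_resSlope (M : d.Matches F e hW1 hD g γ z z' φ Umat ρ Ttop) (r c : F.WIdx) :
    IntervalD.mem (F.resSlope g γ z z' (F.runSlopeOf (F.slopeOfFlat Umat) φ) ρ Ttop r c) (d.Nb (d.eO F e r) (d.eO F e c)) := by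
  classical
  have hne : ∀ p : Fin m × Fin F.W, ((e p : ℕ) = d.n) = False := fun p => by
    simp only [eq_iff_iff, iff_false]; exact (e p).isLt.ne
  have hrow := mem_hrowB M c
  rcases r with _ | ⟨i, j⟩
  · -- section row
    simp only [OneShiftFrame.resSlope, eO, Option.elim, Nb, if_true]
    have hhalf : IntervalD.mem (1 / 2 : ℝ) halfI := by
      have := IntervalD.mem_ofDyad (⟨1, -1⟩ : Dyad)
      simp only [Dyad.toReal] at this
      norm_num at this ⊢
      exact this
    refine IntervalD.mem_mulR d.prec hhalf ?_
    rw [M.hm]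
    refine mem_sum_equiv (Equiv.refl (Fin m)) d.prec fun k hk => ?_
    simp only [Equiv.refl_symm, Equiv.refl_apply]
    have h1 := M.hidxD ⟨k, hk⟩
    simp only at h1
    rw [h1]
    have hz := mem_zsum M ⟨k, hk⟩ ⟨F.D, hD⟩
    have hv := mem_Vb M ⟨k, hk⟩ ⟨F.D, hD⟩ c
    exact IntervalD.mem_mulR d.prec hz hv
  · -- window row (i, j)
    have hr : d.eO F e (some (i, j)) = (e (i, j) : ℕ) := rfl
    rw [hr]
    simp only [OneShiftFrame.resSlope, Nb, hne (i, j), if_false]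
    -- the self-column indicator
    have hself : IntervalD.mem (if c = some (i, j) then F.a i ((j : ℕ) : ℤ) else 0)
        (if d.eO F e c = (e (i, j) : ℕ) then IntervalD.aget d.aBox (e (i, j)) else IntervalD.ofInt 0) := by
      rcases c with _ | p
      · simp only [eO, Option.elim, reduceCtorEq, if_false]
        rw [if_neg (fun h => (e (i, j)).isLt.ne h.symm)]
        exact_mod_cast IntervalD.mem_ofInt 0
      · simp only [eO, Option.elim, Option.some.injEq]
        by_cases hp : p = (i, j)
        · subst hp; simp only [if_true]; exact M.ha i j
        · rw [if_neg hp, if_neg (fun h => hp (e.injective (Fin.ext h)))]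
          exact_mod_cast IntervalD.mem_ofInt 0
    refine IntervalD.mem_subR d.prec ?_ hself
    by_cases hj : (j : ℕ) + 1 < F.W
    · -- one-shift row
      have hsucc := M.hsucc i j
      rw [dif_pos hj] at hsucc
      rw [hsucc]
      simp only
      have hjz : ((j : ℕ) : ℤ) + 1 < F.W := by exact_mod_cast hj
      rw [if_pos hjz]
      have hv := mem_Vb M i ⟨(j : ℕ) + 1, hj⟩ c
      have hz' := M.hz' i ⟨(j : ℕ) + 1, hj⟩
      simp only [Nat.cast_add, Nat.cast_one] at hv hz'
      exact IntervalD.mem_addR d.prec (IntervalD.mem_mulR d.prec M.hg hv)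
        (IntervalD.mem_mulR d.prec (IntervalD.mem_mulR d.prec hz' M.hγ) hrow)
    · -- top row
      have hsucc := M.hsucc i j
      rw [dif_neg hj] at hsucc
      rw [hsucc]
      simp only
      have hjz : ¬ ((j : ℕ) : ℤ) + 1 < F.W := by exact_mod_cast hj
      rw [if_neg hjz, M.hmode i j]
      refine IntervalD.mem_addR d.prec (IntervalD.mem_mulR d.prec M.hg ?_)
        (IntervalD.mem_mulR d.prec (IntervalD.mem_mulR d.prec (M.hT i) M.hγ) hrow)
      rcases c with _ | p
      · simp only [eO, Option.elim, if_true]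
        exact IntervalD.mem_mulR d.prec M.hrτ (mem_sym (M.hρ i))
      · simp only [eO, Option.elim, hne p, reduceCtorEq, if_false]
        exact_mod_cast IntervalD.mem_ofInt 0

end Sound

end ResSlopeD

end DSSOneShift

end Summit.NavierStokesRegularity.NavierStokesRegularity.Theorems
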